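import Summits.MatrixMultiplication.MatrixMultiplication.Theorems.FarEdgeDescentImprovableRate
import HarnessLib

/-!
# Far-edge descent, kernel XXXIII-A: scalar steps of the CEILING of the isolated tower

Route `FarEdgeDescent`, special leaf `FiniteSaturation` (stmt-MatrixMultiplication-23739): helper
kernel, THESES-FREE and def-free; the one-stage inequalities used by kernel XXXIII-B
(`FarEdgeDescentIsolatedCeiling.readout_of_wedge`: the readouts `G_j(s,t) ≤ r_j` of an improvable
squaring chain PASS on a full wedge `s − 1 ≤ c(1−t)^κ`, `κ = log₂(4/3)`, so the rate ladder built on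
them is capped at `θ_S = κ/(1−κ) = log(4/3)/log(3/2) = 0.70951…`).  In the ratios `m = L/r ≤ 1/3`,
`ρ = 1 − 2m = Q/r`, `θ = Q^t/r ≤ ρ`, `γ = G/r` (`m' = m(m+2ρ)`, `γ' = γ(γ+2θ)`):

* `phase_one_step` — anchor alive (`θ ≤ ρ`): `γ ≤ m(1+η)` ⟹ `γ' ≤ m'(1 + (4/3)η + η²/3)`
  (because `m/(m+2ρ) ≤ 1/3`);
* `majorant_step`, `majorant_le` — the Riccati orbit `η' = (4/3)η + η²/3` is majorised in closed form
  by `E(a) = a/(1 − 3a/4)` along `a' = (4/3)a` (the substitution `ψ = η/(1+3η/4)` linearises it);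
* `phase_two_step` — anchor dead (`θ ≤ ρ/2`): `γ ≤ (3/2)m` propagates;
* `anchor_death` — `(1−t) log Q ≥ log 2` ⟹ `Q^t ≤ Q/2`;
* `rpow_le_linear`, `rpow_three_le` — base censuses are linear in `s − 1` on `[1,2]`
  (`a^s ≤ a(1 + (a−1)(s−1))`, weighted AM–GM); `fourThirds_pow_eq` — `(4/3)^n = (2^n)^κ`;
* `ceiling_virtualForm` — the normal form of a stage WITHOUT the readout hypothesis, with the
  anchor-death clause `(1−t)(2^j log r₀ − log 3) ≥ log 2 ⟹ θ_j ≤ ρ_j/2` (since `Q_j ≥ r_j/3`).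

References: Pan 1984 (LNCS 179) §16 Props. 16.2–16.5; Stothers 2010, Thm. 8; Schönhage 1981, §5;
Knuth TAOCP 2, §4.6.4 Ex. 67(g).
Tags: `FiniteSaturation` (h₁) NEC · WEAKER · ATTACKED; support for the ceiling theorem (XXXIII-B).
-/

set_option linter.dupNamespace false

noncomputable section

open scoped BigOperators

namespace Summit.MatrixMultiplication.MatrixMultiplication.Theorems.FarEdgeDescentCeilingSteps

open Literature.Computability.AlgebraicComplexity
open Summit.MatrixMultiplication.MatrixMultiplication.Theorems.FarEdgeDescentImprovableDynamics

/-! ## §1 Scalar steps -/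

/-- **Phase-1 step** (anchor alive).  With `0 ≤ m ≤ 1/3`, `0 ≤ θ ≤ 1 − 2m`, `0 ≤ η` and
`0 ≤ γ ≤ m(1+η)`: `(θ+γ)² − θ² ≤ ((1−m)² − (1−2m)²)·(1 + (4/3)η + η²/3)` — the deviation ratio grows by
at most `(1+η)(1+η/3)/(1+η)`, because `m/(m + 2(1−2m)) ≤ 1/3`. [folklore] -/
theorem phase_one_step {m θ γ η : ℝ} (hm0 : 0 ≤ m) (hm3 : m ≤ 1 / 3) (hθ0 : 0 ≤ θ)
    (hθρ : θ ≤ 1 - 2 * m) (hη : 0 ≤ η) (hγ0 : 0 ≤ γ) (hγ : γ ≤ m * (1 + η)) :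
    (θ + γ) ^ 2 - θ ^ 2 ≤ ((1 - m) ^ 2 - (1 - 2 * m) ^ 2) * (1 + (4 / 3 * η + η ^ 2 / 3)) := by
  have e1 : (θ + γ) ^ 2 - θ ^ 2 = γ * (γ + 2 * θ) := by ring
  have e2 : ((1 - m) ^ 2 - (1 - 2 * m) ^ 2) * (1 + (4 / 3 * η + η ^ 2 / 3)) =
      m * (1 + η) * ((2 - 3 * m) * (1 + η / 3)) := by ring
  rw [e1, e2]
  have hΓ0 : 0 ≤ m * (1 + η) := by positivity
  -- monotone in γ and in θ
  have h1 : γ * (γ + 2 * θ) ≤ m * (1 + η) * (m * (1 + η) + 2 * (1 - 2 * m)) := by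
    have ha : γ + 2 * θ ≤ m * (1 + η) + 2 * (1 - 2 * m) := by linarith
    have hb : 0 ≤ γ + 2 * θ := by linarith
    calc γ * (γ + 2 * θ) ≤ m * (1 + η) * (γ + 2 * θ) := mul_le_mul_of_nonneg_right hγ hb
      _ ≤ m * (1 + η) * (m * (1 + η) + 2 * (1 - 2 * m)) := mul_le_mul_of_nonneg_left ha hΓ0
  have h2 : m * (1 + η) + 2 * (1 - 2 * m) ≤ (2 - 3 * m) * (1 + η / 3) := by nlinarith
  exact h1.trans (mul_le_mul_of_nonneg_left h2 hΓ0)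

/-- **Closed-form majorant of the phase-1 Riccati step**: with `E(a) = a/(1 − 3a/4)`,
`(4/3)E(a) + E(a)²/3 ≤ E(4a/3)` for `0 ≤ a < 3/4` (after clearing denominators this is `0 ≤ a²`;
equivalently `ψ = η/(1 + 3η/4)` satisfies `ψ' ≤ (4/3)ψ`). [folklore] -/
theorem majorant_step {a : ℝ} (ha0 : 0 ≤ a) (ha1 : a < 3 / 4) :
    4 / 3 * (a / (1 - 3 / 4 * a)) + (a / (1 - 3 / 4 * a)) ^ 2 / 3 ≤
      (4 / 3 * a) / (1 - 3 / 4 * (4 / 3 * a)) := by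
  have hb : (0 : ℝ) < 4 - 3 * a := by linarith
  have h1a : (0 : ℝ) < 1 - a := by linarith
  have h1' : (1 : ℝ) - 3 / 4 * a ≠ 0 := by intro h; linarith
  have h2' : (1 : ℝ) - 3 / 4 * (4 / 3 * a) ≠ 0 := by intro h; linarith
  have e1 : a / (1 - 3 / 4 * a) = 4 * a / (4 - 3 * a) := by
    rw [div_eq_div_iff h1' hb.ne']; ring
  have e2 : (4 / 3 * a) / (1 - 3 / 4 * (4 / 3 * a)) = 4 * a / (3 * (1 - a)) := by
    rw [div_eq_div_iff h2' (by positivity)]; ring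
  rw [e1, e2]
  have eL : 4 / 3 * (4 * a / (4 - 3 * a)) + (4 * a / (4 - 3 * a)) ^ 2 / 3 =
      (16 * a * (4 - 3 * a) + 16 * a ^ 2) / (3 * (4 - 3 * a) ^ 2) := by
    rw [eq_div_iff (by positivity), div_pow]
    have hb2 : (4 - 3 * a) ^ 2 ≠ 0 := by positivity
    calc (4 / 3 * (4 * a / (4 - 3 * a)) + (4 * a) ^ 2 / (4 - 3 * a) ^ 2 / 3) * (3 * (4 - 3 * a) ^ 2)
        = 4 * (4 * a / (4 - 3 * a) * (4 - 3 * a)) * (4 - 3 * a) +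
          (4 * a) ^ 2 / (4 - 3 * a) ^ 2 * (4 - 3 * a) ^ 2 := by ring
      _ = 4 * (4 * a) * (4 - 3 * a) + (4 * a) ^ 2 := by
          rw [div_mul_cancel₀ _ hb.ne', div_mul_cancel₀ _ hb2]
      _ = 16 * a * (4 - 3 * a) + 16 * a ^ 2 := by ring
  rw [eL, div_le_div_iff₀ (by positivity) (by positivity)]
  nlinarith [mul_nonneg ha0 (sq_nonneg a), sq_nonneg (4 - 3 * a)]

/-- `a ≤ E(a) = a/(1 − 3a/4)` and `E(a) ≤ 4/13 ≤ 1/2` for `0 ≤ a ≤ 1/4`. [folklore] -/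
theorem majorant_le {a : ℝ} (ha0 : 0 ≤ a) (ha1 : a ≤ 1 / 4) :
    a ≤ a / (1 - 3 / 4 * a) ∧ 0 ≤ a / (1 - 3 / 4 * a) ∧ a / (1 - 3 / 4 * a) ≤ 1 / 2 := by
  have h1 : 0 < 1 - 3 / 4 * a := by linarith
  refine ⟨?_, by positivity, ?_⟩
  · rw [le_div_iff₀ h1]; nlinarith
  · rw [div_le_iff₀ h1]; linarith

/-- **Phase-2 step** (anchor dead).  With `0 ≤ m ≤ 1/3`, `0 ≤ θ ≤ (1 − 2m)/2`, `0 ≤ γ ≤ (3/2)m`: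
`(θ+γ)² − θ² ≤ (3/2)((1−m)² − (1−2m)²)` — the bound `γ ≤ (3/2)m` propagates. [folklore] -/
theorem phase_two_step {m θ γ : ℝ} (hm0 : 0 ≤ m) (hm3 : m ≤ 1 / 3) (hθ0 : 0 ≤ θ)
    (hθρ : θ ≤ (1 - 2 * m) / 2) (hγ0 : 0 ≤ γ) (hγ : γ ≤ 3 / 2 * m) :
    (θ + γ) ^ 2 - θ ^ 2 ≤ 3 / 2 * ((1 - m) ^ 2 - (1 - 2 * m) ^ 2) := by
  have e1 : (θ + γ) ^ 2 - θ ^ 2 = γ * (γ + 2 * θ) := by ring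
  have e2 : 3 / 2 * ((1 - m) ^ 2 - (1 - 2 * m) ^ 2) = 3 / 2 * m * (2 - 3 * m) := by ring
  rw [e1, e2]
  have hΓ0 : 0 ≤ 3 / 2 * m := by positivity
  have h1 : γ * (γ + 2 * θ) ≤ 3 / 2 * m * (3 / 2 * m + (1 - 2 * m)) := by
    have ha : γ + 2 * θ ≤ 3 / 2 * m + (1 - 2 * m) := by linarith
    have hb : 0 ≤ γ + 2 * θ := by linarith
    calc γ * (γ + 2 * θ) ≤ 3 / 2 * m * (γ + 2 * θ) := mul_le_mul_of_nonneg_right hγ hb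
      _ ≤ 3 / 2 * m * (3 / 2 * m + (1 - 2 * m)) := mul_le_mul_of_nonneg_left ha hΓ0
  have h2 : 3 / 2 * m + (1 - 2 * m) ≤ 2 - 3 * m := by linarith
  exact h1.trans (mul_le_mul_of_nonneg_left h2 hΓ0)

/-- **Anchor death**: for `1 ≤ Q` and `(1−t)·log Q ≥ log 2`: `Q^t ≤ Q/2`. [folklore] -/
theorem anchor_death {Q t : ℝ} (hQ : 1 ≤ Q) (h : Real.log 2 ≤ (1 - t) * Real.log Q) :
    Q ^ t ≤ Q / 2 := by
  have hQpos : 0 < Q := by linarith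
  have hsplit : Q ^ t = Q * Q ^ (t - 1) := by
    rw [show t = (t - 1) + 1 by ring, Real.rpow_add_one hQpos.ne', add_sub_cancel_right]; ring
  have h1 : Q ^ (t - 1) ≤ 1 / 2 := by
    rw [Real.rpow_def_of_pos hQpos]
    have h2 : Real.log Q * (t - 1) ≤ -Real.log 2 := by nlinarith
    calc Real.exp (Real.log Q * (t - 1)) ≤ Real.exp (-Real.log 2) := Real.exp_le_exp.2 h2
      _ = 1 / 2 := by rw [Real.exp_neg, Real.exp_log (by norm_num)]; norm_num
  rw [hsplit]
  have : Q * Q ^ (t - 1) ≤ Q * (1 / 2) := mul_le_mul_of_nonneg_left h1 hQpos.le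
  linarith

/-- `a^s ≤ a(1 + (a−1)(s−1))` for `1 ≤ a`, `1 ≤ s ≤ 2` (weighted AM–GM: `a^σ ≤ (1−σ) + σa` on
`[0,1]`): the base census of a Schönhage gadget is linear in `s − 1`. [folklore] -/
theorem rpow_le_linear {a s : ℝ} (ha : 1 ≤ a) (hs1 : 1 ≤ s) (hs2 : s ≤ 2) :
    a ^ s ≤ a * (1 + (a - 1) * (s - 1)) := by
  have h := Real.geom_mean_le_arith_mean2_weighted (w₁ := 1 - (s - 1)) (w₂ := s - 1) (p₁ := 1)
    (p₂ := a) (by linarith) (by linarith) (by norm_num) (by linarith) (by ring)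
  rw [Real.one_rpow, one_mul] at h
  have ha0 : 0 < a := by linarith
  have e : a ^ s = a * a ^ (s - 1) := by
    rw [show s = (s - 1) + 1 by ring, Real.rpow_add_one ha0.ne', add_sub_cancel_right]; ring
  rw [e]
  have h2 : a ^ (s - 1) ≤ 1 + (a - 1) * (s - 1) := by linarith
  exact mul_le_mul_of_nonneg_left h2 ha0.le

/-- `3^s ≤ 3(1 + 2(s−1))` for `1 ≤ s ≤ 2` (weighted AM–GM: `3^σ ≤ 1 + 2σ` on `[0,1]`). [folklore] -/
theorem rpow_three_le {s : ℝ} (hs1 : 1 ≤ s) (hs2 : s ≤ 2) :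
    (3 : ℝ) ^ s ≤ 3 * (1 + 2 * (s - 1)) := by
  have h := Real.geom_mean_le_arith_mean2_weighted (w₁ := 1 - (s - 1)) (w₂ := s - 1) (p₁ := 1)
    (p₂ := 3) (by linarith) (by linarith) (by norm_num) (by norm_num) (by ring)
  rw [Real.one_rpow, one_mul] at h
  have e : (3 : ℝ) ^ s = 3 * (3 : ℝ) ^ (s - 1) := by
    rw [show s = (s - 1) + 1 by ring, Real.rpow_add_one (by norm_num : (3 : ℝ) ≠ 0),
      add_sub_cancel_right]; ring
  rw [e]
  linarith

/-- `(4/3)^n = (2^n)^κ`, `κ = log₂(4/3)`. [folklore] -/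
theorem fourThirds_pow_eq (n : ℕ) :
    ((4 : ℝ) / 3) ^ n = ((2 : ℝ) ^ n) ^ Real.logb 2 ((4 : ℝ) / 3) := by
  rw [← Real.rpow_natCast ((2 : ℝ)) n, ← Real.rpow_mul (by norm_num : (0 : ℝ) ≤ 2), mul_comm,
    Real.rpow_mul (by norm_num : (0 : ℝ) ≤ 2), Real.rpow_logb (by norm_num) (by norm_num) (by norm_num),
    Real.rpow_natCast]

/-! ## §2 Normal form of a stage without the readout hypothesis -/

section Chain

variable (r Q L : ℕ → ℕ) (G : ℕ → ℝ → ℝ → ℝ)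

/-- **Normal form of a stage without the readout hypothesis**: `0 ≤ θ_j ≤ 1 − 2m_j`, `0 ≤ γ_j`,
`γ_{j+1} = (θ_j+γ_j)² − θ_j²`, and ANCHOR DEATH: if `(1−t)(2^j log r₀ − log 3) ≥ log 2` then
`θ_j ≤ (1 − 2m_j)/2` (because `Q_j ≥ r_j/3 = r₀^(2^j)/3`). [folklore] -/
theorem ceiling_virtualForm (hsum : ∀ j, Q j + 2 * L j = r j) (hQ1 : ∀ j, 1 ≤ Q j)
    (hm0 : 3 * L 0 ≤ r 0) (hL : ∀ j, L (j + 1) = (Q j + L j) ^ 2 - Q j ^ 2)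
    (hr : ∀ j, r (j + 1) = r j ^ 2) (hG0 : ∀ s t : ℝ, 0 ≤ G 0 s t)
    (hG : ∀ j (s t : ℝ), G (j + 1) s t = (((Q j : ℕ) : ℝ) ^ t + G j s t) ^ 2 - (((Q j : ℕ) : ℝ) ^ t) ^ 2)
    {s t : ℝ} (ht1 : t ≤ 1) (j : ℕ) :
    0 ≤ ((Q j : ℕ) : ℝ) ^ t / r j ∧ ((Q j : ℕ) : ℝ) ^ t / r j ≤ 1 - 2 * ((L j : ℝ) / r j) ∧
      0 ≤ G j s t / r j ∧
      G (j + 1) s t / r (j + 1) = (((Q j : ℕ) : ℝ) ^ t / r j + G j s t / r j) ^ 2 -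
        (((Q j : ℕ) : ℝ) ^ t / r j) ^ 2 ∧
      (Real.log 2 ≤ (1 - t) * (2 ^ j * Real.log (r 0) - Real.log 3) →
        ((Q j : ℕ) : ℝ) ^ t / r j ≤ (1 - 2 * ((L j : ℝ) / r j)) / 2) := by
  obtain ⟨hrpos, hm0', hm3, hρ, -⟩ := improvable_normalForm r Q L hsum hQ1 hm0 hL hr j
  have hQ1R : (1 : ℝ) ≤ ((Q j : ℕ) : ℝ) := by exact_mod_cast hQ1 j
  have hsumR : ((Q j : ℕ) : ℝ) + 2 * L j = r j := by exact_mod_cast hsum j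
  have hQr : ((Q j : ℕ) : ℝ) ≤ r j := by
    have := hsum j; exact_mod_cast (show Q j ≤ r j by omega)
  have hQt0 : 0 ≤ ((Q j : ℕ) : ℝ) ^ t := Real.rpow_nonneg (by linarith) t
  have hQt1 : ((Q j : ℕ) : ℝ) ^ t ≤ ((Q j : ℕ) : ℝ) := by
    have h := Real.rpow_le_rpow_of_exponent_le hQ1R ht1
    rwa [Real.rpow_one] at h
  have hGn : ∀ i, 0 ≤ G i s t := by
    intro i
    induction i with
    | zero => exact hG0 s t
    | succ i ih =>
      rw [hG]
      have hq : 0 ≤ ((Q i : ℕ) : ℝ) ^ t := Real.rpow_nonneg (Nat.cast_nonneg _) t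
      nlinarith
  refine ⟨by positivity, ?_, div_nonneg (hGn j) hrpos.le, ?_, ?_⟩
  · rw [hρ]; exact div_le_div_of_nonneg_right hQt1 hrpos.le
  · have hrR : (r (j + 1) : ℝ) = (r j : ℝ) ^ 2 := by rw [hr j]; push_cast; ring
    rw [hG, hrR]
    field_simp
  · intro hdead
    -- `Q_j ≥ r_j / 3`, so `log Q_j ≥ 2^j log r₀ − log 3`
    have h3L : 3 * (L j : ℝ) ≤ r j := by
      have h := hm3
      rw [div_le_iff₀ hrpos] at h
      linarith
    have hQlow : (r j : ℝ) / 3 ≤ ((Q j : ℕ) : ℝ) := by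
      rw [div_le_iff₀ (by norm_num : (0 : ℝ) < 3)]
      linarith
    have hlogr : Real.log (r j : ℝ) = 2 ^ j * Real.log (r 0) := by
      rw [r_eq_pow r hr j]; push_cast; rw [Real.log_pow]; push_cast; ring
    have hlogQ : 2 ^ j * Real.log (r 0) - Real.log 3 ≤ Real.log ((Q j : ℕ) : ℝ) := by
      have h := Real.log_le_log (by positivity) hQlow
      rw [Real.log_div hrpos.ne' (by norm_num), hlogr] at h
      exact h
    have hu0 : 0 ≤ 1 - t := by linarith
    have hkey : Real.log 2 ≤ (1 - t) * Real.log ((Q j : ℕ) : ℝ) :=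
      hdead.trans (mul_le_mul_of_nonneg_left hlogQ hu0)
    have hd := anchor_death hQ1R hkey
    rw [hρ]
    calc ((Q j : ℕ) : ℝ) ^ t / r j ≤ (((Q j : ℕ) : ℝ) / 2) / r j :=
          div_le_div_of_nonneg_right hd hrpos.le
      _ = ((Q j : ℕ) : ℝ) / r j / 2 := by ring

end Chain

end Summit.MatrixMultiplication.MatrixMultiplication.Theorems.FarEdgeDescentCeilingSteps

end
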